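import Literature.Analysis.FunctionSpaces.TorusSobolevSup
import Literature.MathematicalPhysics.KineticTheory.HardSphereEuler
import HarnessLib

/-!
# Sup / `C¹` bounds from weighted `L²` energies and `(2,2)`-products via `L⁴` on `𝕋³`

MathematicalPhysics/KineticTheory proof file (theorems only; no definitions, no named facts):
the two Sobolev tools of the `H³` energy method for classical solutions of quasilinear symmetric
hyperbolic systems on the flat three-torus (T. Kato, ARMA 58 (1975); A. Majda 1984, Ch. 2,
proof of Thm 2.1: the `Hˢ` energy, `s > 3/2 + 1`, controls the `C¹` norm — Sobolev — and the
commutator terms are estimated with Gagliardo–Nirenberg / Moser inequalities; on `𝕋³` with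
`s = 3` the only non-`(sup × L²)` products are the `(2,2)` ones, handled by `H¹ ⊂ L⁴`). They
serve layer 4 (the fixed-horizon a-priori stability estimate) of the proof of
`hsEuler_continuousDependence` (`HardSphereEulerContinuousDependenceProofs.lean`), where the
difference `δV = (δρ, δu, δθ)` of a `σ`-solution and the ideal reference is measured in the
WEIGHTED level energies `E_k = Σ_{|α| = k} ∫ ½ (A (∂^α δρ)² + ρ ‖∂^α δu‖² + B (∂^α δθ)²)`
(Friedrichs weights `ω ∈ {A, ρ, B}`, continuous and `≥ m > 0`). Everything is in the helper
namespace `HsEulerCalc`; `T3 = UnitAddTorus (Fin 3)`, `V3 = EuclideanSpace ℝ (Fin 3)`, Bochner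
integrals for the Haar probability measure `volume`, nesting
`∂ⱼ ∂ᵢ ∂ₗ f = Torus.partialDeriv j (Torus.partialDeriv i (Torus.partialDeriv l f))`.

* `torus_integral_sq_le_of_le_weight` / `torus_integral_norm_sq_le_of_le_weight` — weighted to
  plain `L²`: `∫ g² ≤ m⁻¹ ∫ ω g²`;
* `sup_le_of_weighted_energies` — ONE constant `K > 0` with, for every continuous weight
  `ω ≥ m > 0` and every smooth real- or `V3`-valued `f` on `𝕋³`,
  `‖f x‖² ≤ K m⁻¹ (∫ ω ‖f‖² + Σᵢ ∫ ω ‖∂ᵢ f‖² + Σⱼ Σᵢ ∫ ω ‖∂ⱼ ∂ᵢ f‖²)` and the analogous bound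
  of `‖∂ₗ f x‖²` by the levels `1–3` (Sobolev `H²(𝕋³) ⊂ L^∞`, Adams 1975 Thm 5.4 Part I Case C,
  through `Torus.exists_norm_sq_le_sobolev_two` of `TorusSobolevSup.lean`);
* `torus_integral_pow_four_le_sobolev_one` / `torus_integral_norm_pow_four_le_sobolev_one` —
  `H¹(𝕋³) ⊂ L⁴(𝕋³)` in Bochner form: `∫ ‖f‖⁴ ≤ KS (∫ ‖f‖² + Σᵢ ∫ ‖∂ᵢ f‖²)²` for smooth `f`
  (from `Torus.lintegral_enorm_pow_four_le_sq_of_isSmooth`, `TorusSobolevL4.lean`);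
* `torus_integral_abs_mul_mul_le_L4_L4_L2` — Hölder `(4,4,2)`: `∫ |f||g||h| ≤
  (∫ f⁴)^{1/4} (∫ g⁴)^{1/4} (∫ h²)^{1/2}`;
* `torus_l4_product_bound` / `torus_l4_product_bound_weighted` — the packaged `(2,2)`-product
  tool `∫ |w||f||g||h| ≤ KS M √(m₁⁻¹ N_{ω₁} f) √(m₂⁻¹ N_{ω₂} g) √(m₃⁻¹ ∫ ω₃ h²)`,
  `N_ω f = ∫ ω f² + Σᵢ ∫ ω (∂ᵢ f)²`.

Ported from the summit-side helper files `Summits/AtomisticToContinuum/HydrodynamicLimit/Theorems/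
ImplosionDichotomyPolynomialCompression{SupFromEnergy,TorusL4Products}.lean` (Literature may not
import Summits, CONVENTIONS §2; the summit copies become the redundant ones).

## Mathlib / tree search

Tree: `Torus.exists_norm_sq_le_sobolev_two` (`TorusSobolevSup.lean`),
`Torus.lintegral_enorm_pow_four_le_sq_of_isSmooth` (`TorusSobolevL4.lean`),
`Torus.norm_fderiv_sq_le_card_mul_sum`, `Torus.IsSmooth.partialDeriv`,
`Continuous.integrable_unitAddTorus`. Mathlib: `integral_mul_le_Lp_mul_Lq_of_nonneg` (Hölder),
`MeasureTheory.ofReal_integral_eq_lintegral_ofReal`.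

## References

* R. A. Adams, *Sobolev Spaces*, Academic Press 1975: Thm 5.4 Part I Case C (`mp > n`),
  Case B (`H¹ ⊂ L⁴ ⊂ L⁶` in dimension `3`), Lemma 5.15. [`Adams1975`]
* A. Majda, *Compressible Fluid Flow and Systems of Conservation Laws in Several Space
  Variables*, Appl. Math. Sci. 53, Springer 1984: Ch. 2, §2.1, proof of Thm 2.1 (Sobolev and
  Moser-type calculus inequalities in the `Hˢ` energy estimate). [`Majda1984`]
-/

noncomputable section

open MeasureTheory
open scoped ENNReal NNReal

namespace Literature.MathematicalPhysics.KineticTheory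

open Literature.Analysis.FunctionSpaces

namespace HsEulerCalc

/-! ### (M1) weighted to plain `L²` -/

/-- (M1), general normed target: for a continuous `g : 𝕋³ → F'`, a continuous weight `ω` and
`0 < m ≤ ω`, `∫ ‖g‖² ≤ m⁻¹ ∫ ω ‖g‖²`. [folklore] -/
private theorem integral_norm_sq_le_of_le_weight_aux {F' : Type*} [NormedAddCommGroup F']
    {g : T3 → F'} {ω : T3 → ℝ} {m : ℝ} (hg : Continuous g) (hω : Continuous ω) (hm : 0 < m)
    (hle : ∀ x, m ≤ ω x) : ∫ x, ‖g x‖ ^ 2 ≤ m⁻¹ * ∫ x, ω x * ‖g x‖ ^ 2 := by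
  have hi1 : Integrable (fun x => ‖g x‖ ^ 2) volume := (hg.norm.pow 2).integrable_unitAddTorus
  have hi2 : Integrable (fun x => ω x * ‖g x‖ ^ 2) volume :=
    (hω.mul (hg.norm.pow 2)).integrable_unitAddTorus
  rw [le_inv_mul_iff₀ hm, ← integral_const_mul]
  exact integral_mono (hi1.const_mul m) hi2 fun x =>
    mul_le_mul_of_nonneg_right (hle x) (sq_nonneg _)

/-- **(M1), real-valued.** For continuous `g, ω : 𝕋³ → ℝ` with `0 < m ≤ ω x` for all `x`,
`∫ g² ≤ m⁻¹ ∫ ω g²` (both integrands are continuous, hence integrable on the compact torus).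
[folklore] -/
theorem torus_integral_sq_le_of_le_weight :
    ∀ {g ω : T3 → ℝ} {m : ℝ}, Continuous g → Continuous ω → 0 < m → (∀ x, m ≤ ω x) →
      ∫ x, g x ^ 2 ≤ m⁻¹ * ∫ x, ω x * g x ^ 2 := by
  intro g ω m hg hω hm hle
  have h := integral_norm_sq_le_of_le_weight_aux hg hω hm hle
  simp only [Real.norm_eq_abs, sq_abs] at h
  exact h

/-- **(M1), vector-valued.** For a continuous `g : 𝕋³ → V3`, a continuous weight `ω : 𝕋³ → ℝ`
and `0 < m ≤ ω x` for all `x`, `∫ ‖g‖² ≤ m⁻¹ ∫ ω ‖g‖²`. [folklore] -/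
theorem torus_integral_norm_sq_le_of_le_weight :
    ∀ {g : T3 → V3} {ω : T3 → ℝ} {m : ℝ}, Continuous g → Continuous ω → 0 < m →
      (∀ x, m ≤ ω x) → ∫ x, ‖g x‖ ^ 2 ≤ m⁻¹ * ∫ x, ω x * ‖g x‖ ^ 2 := by
  intro g ω m hg hω hm hle
  exact integral_norm_sq_le_of_le_weight_aux hg hω hm hle

/-! ### (M3) and (M2) for a general finite-dimensional target, Sobolev constant as a parameter -/

section General

variable {F' : Type*} [NormedAddCommGroup F'] [NormedSpace ℝ F']

/-- (M3) with the Sobolev bound as a hypothesis: if `‖f x‖² ≤ K (∫ ‖f‖² + Σᵢ ∫ ‖∂ᵢ f‖²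
+ Σᵢ Σⱼ ∫ ‖∂ᵢ ∂ⱼ f‖²)` for all smooth `f : 𝕋³ → F'` (with `K ≥ 0`), then for every continuous
weight `ω ≥ m > 0`, `‖f x‖² ≤ K m⁻¹ (∫ ω ‖f‖² + Σᵢ ∫ ω ‖∂ᵢ f‖² + Σⱼ Σᵢ ∫ ω ‖∂ⱼ ∂ᵢ f‖²)`.
[folklore] -/
private theorem norm_sq_le_weighted_aux {K : ℝ} (hK0 : 0 ≤ K)
    (hK : ∀ f : T3 → F', Torus.IsSmooth f → ∀ x,
      ‖f x‖ ^ 2 ≤ K * ((∫ y, ‖f y‖ ^ 2) + (∑ i, ∫ y, ‖Torus.partialDeriv i f y‖ ^ 2) +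
        ∑ i, ∑ j, ∫ y, ‖Torus.partialDeriv i (Torus.partialDeriv j f) y‖ ^ 2))
    {ω : T3 → ℝ} {m : ℝ} (hω : Continuous ω) (hm : 0 < m) (hle : ∀ x, m ≤ ω x)
    {f : T3 → F'} (hf : Torus.IsSmooth f) (x : T3) :
    ‖f x‖ ^ 2 ≤ K * m⁻¹ * ((∫ y, ω y * ‖f y‖ ^ 2) +
      (∑ i, ∫ y, ω y * ‖Torus.partialDeriv i f y‖ ^ 2) +
        ∑ j, ∑ i, ∫ y, ω y * ‖Torus.partialDeriv j (Torus.partialDeriv i f) y‖ ^ 2) := by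
  have h0 : ∫ y, ‖f y‖ ^ 2 ≤ m⁻¹ * ∫ y, ω y * ‖f y‖ ^ 2 :=
    integral_norm_sq_le_of_le_weight_aux hf.continuous hω hm hle
  have h1 : ∀ i, ∫ y, ‖Torus.partialDeriv i f y‖ ^ 2 ≤
      m⁻¹ * ∫ y, ω y * ‖Torus.partialDeriv i f y‖ ^ 2 := fun i =>
    integral_norm_sq_le_of_le_weight_aux (hf.partialDeriv i).continuous hω hm hle
  have h2 : ∀ j i, ∫ y, ‖Torus.partialDeriv j (Torus.partialDeriv i f) y‖ ^ 2 ≤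
      m⁻¹ * ∫ y, ω y * ‖Torus.partialDeriv j (Torus.partialDeriv i f) y‖ ^ 2 := fun j i =>
    integral_norm_sq_le_of_le_weight_aux ((hf.partialDeriv i).partialDeriv j).continuous hω hm hle
  calc ‖f x‖ ^ 2 ≤ K * ((∫ y, ‖f y‖ ^ 2) + (∑ i, ∫ y, ‖Torus.partialDeriv i f y‖ ^ 2) +
        ∑ j, ∑ i, ∫ y, ‖Torus.partialDeriv j (Torus.partialDeriv i f) y‖ ^ 2) := hK f hf x
    _ ≤ K * ((m⁻¹ * ∫ y, ω y * ‖f y‖ ^ 2) +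
        (∑ i, m⁻¹ * ∫ y, ω y * ‖Torus.partialDeriv i f y‖ ^ 2) +
          ∑ j, ∑ i, m⁻¹ * ∫ y, ω y * ‖Torus.partialDeriv j (Torus.partialDeriv i f) y‖ ^ 2) := by
        exact mul_le_mul_of_nonneg_left
          (add_le_add (add_le_add h0 (Finset.sum_le_sum fun i _ => h1 i))
            (Finset.sum_le_sum fun j _ => Finset.sum_le_sum fun i _ => h2 j i)) hK0
    _ = K * m⁻¹ * ((∫ y, ω y * ‖f y‖ ^ 2) +
        (∑ i, ∫ y, ω y * ‖Torus.partialDeriv i f y‖ ^ 2) +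
          ∑ j, ∑ i, ∫ y, ω y * ‖Torus.partialDeriv j (Torus.partialDeriv i f) y‖ ^ 2) := by
        simp only [← Finset.mul_sum]
        ring

/-- (M2) with the Sobolev bound as a hypothesis: under the hypothesis of
`norm_sq_le_weighted_aux`, for every continuous weight `ω ≥ m > 0`, every smooth `f : 𝕋³ → F'`
and every direction `l`, `‖∂ₗ f x‖² ≤ K m⁻¹ (Σ_{l'} ∫ ω ‖∂_{l'} f‖² + Σᵢ Σ_{l'} ∫ ω ‖∂ᵢ ∂_{l'} f‖²
+ Σⱼ Σᵢ Σ_{l'} ∫ ω ‖∂ⱼ ∂ᵢ ∂_{l'} f‖²)` ((M3) for `∂ₗ f`, then single-index terms are bounded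
by the full sums of nonnegative terms). [folklore] -/
private theorem norm_sq_partialDeriv_le_weighted_aux {K : ℝ} (hK0 : 0 ≤ K)
    (hK : ∀ f : T3 → F', Torus.IsSmooth f → ∀ x,
      ‖f x‖ ^ 2 ≤ K * ((∫ y, ‖f y‖ ^ 2) + (∑ i, ∫ y, ‖Torus.partialDeriv i f y‖ ^ 2) +
        ∑ i, ∑ j, ∫ y, ‖Torus.partialDeriv i (Torus.partialDeriv j f) y‖ ^ 2))
    {ω : T3 → ℝ} {m : ℝ} (hω : Continuous ω) (hm : 0 < m) (hle : ∀ x, m ≤ ω x)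
    {f : T3 → F'} (hf : Torus.IsSmooth f) (l : Fin 3) (x : T3) :
    ‖Torus.partialDeriv l f x‖ ^ 2 ≤ K * m⁻¹ *
      ((∑ l', ∫ y, ω y * ‖Torus.partialDeriv l' f y‖ ^ 2) +
        (∑ i, ∑ l', ∫ y, ω y * ‖Torus.partialDeriv i (Torus.partialDeriv l' f) y‖ ^ 2) +
          ∑ j, ∑ i, ∑ l', ∫ y, ω y *
            ‖Torus.partialDeriv j (Torus.partialDeriv i (Torus.partialDeriv l' f)) y‖ ^ 2) := by
  have hωm : ∀ y, 0 ≤ ω y := fun y => hm.le.trans (hle y)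
  have hKm : 0 ≤ K * m⁻¹ := mul_nonneg hK0 (inv_nonneg.2 hm.le)
  -- (M3) for the smooth field `∂ₗ f`
  have h := norm_sq_le_weighted_aux hK0 hK hω hm hle (hf.partialDeriv l) x
  refine h.trans (mul_le_mul_of_nonneg_left ?_ hKm)
  -- enlarge single-index terms to full sums
  have e0 : ∫ y, ω y * ‖Torus.partialDeriv l f y‖ ^ 2 ≤
      ∑ l', ∫ y, ω y * ‖Torus.partialDeriv l' f y‖ ^ 2 :=
    Finset.single_le_sum (f := fun l' => ∫ y, ω y * ‖Torus.partialDeriv l' f y‖ ^ 2)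
      (fun l' _ => integral_nonneg fun y => mul_nonneg (hωm y) (sq_nonneg _)) (Finset.mem_univ l)
  have e1 : ∑ i, ∫ y, ω y * ‖Torus.partialDeriv i (Torus.partialDeriv l f) y‖ ^ 2 ≤
      ∑ i, ∑ l', ∫ y, ω y * ‖Torus.partialDeriv i (Torus.partialDeriv l' f) y‖ ^ 2 :=
    Finset.sum_le_sum fun i _ =>
      Finset.single_le_sum
        (f := fun l' => ∫ y, ω y * ‖Torus.partialDeriv i (Torus.partialDeriv l' f) y‖ ^ 2)
        (fun l' _ => integral_nonneg fun y => mul_nonneg (hωm y) (sq_nonneg _)) (Finset.mem_univ l)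
  have e2 : ∑ j, ∑ i, ∫ y, ω y *
        ‖Torus.partialDeriv j (Torus.partialDeriv i (Torus.partialDeriv l f)) y‖ ^ 2 ≤
      ∑ j, ∑ i, ∑ l', ∫ y, ω y *
        ‖Torus.partialDeriv j (Torus.partialDeriv i (Torus.partialDeriv l' f)) y‖ ^ 2 :=
    Finset.sum_le_sum fun j _ => Finset.sum_le_sum fun i _ =>
      Finset.single_le_sum
        (f := fun l' => ∫ y, ω y *
          ‖Torus.partialDeriv j (Torus.partialDeriv i (Torus.partialDeriv l' f)) y‖ ^ 2)
        (fun l' _ => integral_nonneg fun y => mul_nonneg (hωm y) (sq_nonneg _)) (Finset.mem_univ l)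
  exact add_le_add (add_le_add e0 e1) e2

end General

/-! ### The Sobolev constant, common to real- and `V3`-valued fields -/

/-- One constant `K > 0` for which the `H² ⊂ L^∞` bound of `Torus.exists_norm_sq_le_sobolev_two`
holds both for real-valued and for `V3`-valued smooth fields on `𝕋³` (the maximum of the two
constants; the bracket is nonnegative). [folklore] -/
private theorem exists_common_sobolev_constant :
    ∃ K : ℝ, 0 < K ∧
      (∀ f : T3 → ℝ, Torus.IsSmooth f → ∀ x,
        ‖f x‖ ^ 2 ≤ K * ((∫ y, ‖f y‖ ^ 2) + (∑ i, ∫ y, ‖Torus.partialDeriv i f y‖ ^ 2) +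
          ∑ i, ∑ j, ∫ y, ‖Torus.partialDeriv i (Torus.partialDeriv j f) y‖ ^ 2)) ∧
      (∀ f : T3 → V3, Torus.IsSmooth f → ∀ x,
        ‖f x‖ ^ 2 ≤ K * ((∫ y, ‖f y‖ ^ 2) + (∑ i, ∫ y, ‖Torus.partialDeriv i f y‖ ^ 2) +
          ∑ i, ∑ j, ∫ y, ‖Torus.partialDeriv i (Torus.partialDeriv j f) y‖ ^ 2)) := by
  obtain ⟨K₁, hK₁, h₁⟩ := Torus.exists_norm_sq_le_sobolev_two ℝ
  obtain ⟨K₂, hK₂, h₂⟩ := Torus.exists_norm_sq_le_sobolev_two V3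
  refine ⟨max K₁ K₂, lt_max_of_lt_left hK₁, fun f hf x => ?_, fun f hf x => ?_⟩
  · refine (h₁ f hf x).trans (mul_le_mul_of_nonneg_right (le_max_left _ _) ?_)
    positivity
  · refine (h₂ f hf x).trans (mul_le_mul_of_nonneg_right (le_max_right _ _) ?_)
    positivity

/-! ### (M3) + (M2): the registered statement -/

/-- **Sup and `C¹` bounds from weighted energies (`H²(𝕋³) ⊂ L^∞`).** There is ONE constant
`K > 0` such that for every continuous weight `ω : 𝕋³ → ℝ` with `0 < m ≤ ω x` for all `x`:
(M3, real) every smooth `f : 𝕋³ → ℝ` satisfies, at every `x`,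
`f x² ≤ K m⁻¹ (∫ ω f² + Σᵢ ∫ ω (∂ᵢ f)² + Σⱼ Σᵢ ∫ ω (∂ⱼ ∂ᵢ f)²)`;
(M3, vector) every smooth `f : 𝕋³ → V3` satisfies
`‖f x‖² ≤ K m⁻¹ (∫ ω ‖f‖² + Σᵢ ∫ ω ‖∂ᵢ f‖² + Σⱼ Σᵢ ∫ ω ‖∂ⱼ ∂ᵢ f‖²)`;
(M2, real) every smooth `f : 𝕋³ → ℝ` and direction `l` satisfy
`(∂ₗ f x)² ≤ K m⁻¹ (Σ_{l'} ∫ ω (∂_{l'} f)² + Σᵢ Σ_{l'} ∫ ω (∂ᵢ ∂_{l'} f)²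
  + Σⱼ Σᵢ Σ_{l'} ∫ ω (∂ⱼ ∂ᵢ ∂_{l'} f)²)`;
(M2, vector) the same with norms for smooth `f : 𝕋³ → V3`.
Sobolev `H² ⊂ L^∞` on `𝕋³` (Adams 1975, Thm. 5.4 Part I Case C, through
`Torus.exists_norm_sq_le_sobolev_two`), then (M1) on each integral; for (M2) applied to the smooth
field `∂ₗ f` and enlarged to full index sums by nonnegativity. [folklore] -/
theorem sup_le_of_weighted_energies :
    ∃ K : ℝ, 0 < K ∧
      (∀ {ω : T3 → ℝ} {m : ℝ}, Continuous ω → 0 < m → (∀ x, m ≤ ω x) →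
        ∀ {f : T3 → ℝ}, Torus.IsSmooth f → ∀ x : T3,
          f x ^ 2 ≤ K * m⁻¹ * ((∫ y, ω y * f y ^ 2) +
            (∑ i, ∫ y, ω y * Torus.partialDeriv i f y ^ 2) +
              ∑ j, ∑ i, ∫ y, ω y * Torus.partialDeriv j (Torus.partialDeriv i f) y ^ 2)) ∧
      (∀ {ω : T3 → ℝ} {m : ℝ}, Continuous ω → 0 < m → (∀ x, m ≤ ω x) →
        ∀ {f : T3 → V3}, Torus.IsSmooth f → ∀ x : T3,
          ‖f x‖ ^ 2 ≤ K * m⁻¹ * ((∫ y, ω y * ‖f y‖ ^ 2) +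
            (∑ i, ∫ y, ω y * ‖Torus.partialDeriv i f y‖ ^ 2) +
              ∑ j, ∑ i, ∫ y, ω y * ‖Torus.partialDeriv j (Torus.partialDeriv i f) y‖ ^ 2)) ∧
      (∀ {ω : T3 → ℝ} {m : ℝ}, Continuous ω → 0 < m → (∀ x, m ≤ ω x) →
        ∀ {f : T3 → ℝ}, Torus.IsSmooth f → ∀ (l : Fin 3) (x : T3),
          Torus.partialDeriv l f x ^ 2 ≤ K * m⁻¹ *
            ((∑ l', ∫ y, ω y * Torus.partialDeriv l' f y ^ 2) +
              (∑ i, ∑ l', ∫ y, ω y * Torus.partialDeriv i (Torus.partialDeriv l' f) y ^ 2) +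
                ∑ j, ∑ i, ∑ l', ∫ y, ω y *
                  Torus.partialDeriv j (Torus.partialDeriv i (Torus.partialDeriv l' f)) y ^ 2)) ∧
      (∀ {ω : T3 → ℝ} {m : ℝ}, Continuous ω → 0 < m → (∀ x, m ≤ ω x) →
        ∀ {f : T3 → V3}, Torus.IsSmooth f → ∀ (l : Fin 3) (x : T3),
          ‖Torus.partialDeriv l f x‖ ^ 2 ≤ K * m⁻¹ *
            ((∑ l', ∫ y, ω y * ‖Torus.partialDeriv l' f y‖ ^ 2) +
              (∑ i, ∑ l', ∫ y, ω y * ‖Torus.partialDeriv i (Torus.partialDeriv l' f) y‖ ^ 2) +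
                ∑ j, ∑ i, ∑ l', ∫ y, ω y *
                  ‖Torus.partialDeriv j
                    (Torus.partialDeriv i (Torus.partialDeriv l' f)) y‖ ^ 2)) := by
  obtain ⟨K, hK, hℝ, hV⟩ := exists_common_sobolev_constant
  refine ⟨K, hK, ?_, ?_, ?_, ?_⟩
  · intro ω m hω hm hle f hf x
    have h := norm_sq_le_weighted_aux hK.le hℝ hω hm hle hf x
    simp only [Real.norm_eq_abs, sq_abs] at h
    exact h
  · intro ω m hω hm hle f hf x
    exact norm_sq_le_weighted_aux hK.le hV hω hm hle hf x
  · intro ω m hω hm hle f hf l x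
    have h := norm_sq_partialDeriv_le_weighted_aux hK.le hℝ hω hm hle hf l x
    simp only [Real.norm_eq_abs, sq_abs] at h
    exact h
  · intro ω m hω hm hle f hf l x
    exact norm_sq_partialDeriv_le_weighted_aux hK.le hV hω hm hle hf l x

/-! ### Conversions and Cauchy–Schwarz for continuous functions on `𝕋³` -/

/-- `∫⁻ ‖g‖ₑⁿ = ofReal (∫ ‖g‖ⁿ)` for a continuous `g` on the (compact) torus `𝕋³`. [folklore] -/
private theorem lintegral_enorm_pow_eq_ofReal {F' : Type*} [NormedAddCommGroup F'] {g : T3 → F'}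
    (hg : Continuous g) (n : ℕ) :
    ∫⁻ y, ‖g y‖ₑ ^ n = ENNReal.ofReal (∫ y, ‖g y‖ ^ n) := by
  have hi : Integrable (fun y => ‖g y‖ ^ n) volume := (hg.norm.pow n).integrable_unitAddTorus
  rw [ofReal_integral_eq_lintegral_ofReal hi (ae_of_all _ fun y => pow_nonneg (norm_nonneg _) n)]
  exact lintegral_congr fun y => by rw [← ofReal_norm, ENNReal.ofReal_pow (norm_nonneg _)]

/-- Cauchy–Schwarz for nonnegative continuous real functions on `𝕋³`, Bochner form:
`∫ f g ≤ √(∫ f²) √(∫ g²)` (Mathlib's Hölder inequality `integral_mul_le_Lp_mul_Lq_of_nonneg`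
with `p = q = 2`). [folklore] -/
private theorem integral_mul_le_sqrt_mul_sqrt {f g : T3 → ℝ} (hf : Continuous f)
    (hg : Continuous g) (hf0 : ∀ x, 0 ≤ f x) (hg0 : ∀ x, 0 ≤ g x) :
    ∫ x, f x * g x ≤ Real.sqrt (∫ x, f x ^ 2) * Real.sqrt (∫ x, g x ^ 2) := by
  have h2 : ENNReal.ofReal (2 : ℝ) = 2 := by simp
  have hfm : MemLp f 2 volume := hf.memLp_of_hasCompactSupport (HasCompactSupport.of_compactSpace f)
  have hgm : MemLp g 2 volume := hg.memLp_of_hasCompactSupport (HasCompactSupport.of_compactSpace g)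
  have hH := integral_mul_le_Lp_mul_Lq_of_nonneg (μ := volume) Real.HolderConjugate.two_two
    (ae_of_all _ hf0) (ae_of_all _ hg0) (by rw [h2]; exact hfm) (by rw [h2]; exact hgm)
  simp only [Real.rpow_two] at hH
  rwa [Real.sqrt_eq_rpow, Real.sqrt_eq_rpow]

/-! ### `H¹(𝕋³) ⊂ L⁴(𝕋³)` for smooth fields, Bochner form -/

section General

variable {F' : Type*} [NormedAddCommGroup F'] [NormedSpace ℝ F'] [FiniteDimensional ℝ F']

/-- `H¹(𝕋³) ⊂ L⁴(𝕋³)` for smooth fields with values in a finite-dimensional space, Bochner form: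
there is `K > 0` (depending only on `F'`) with `∫ ‖f‖⁴ ≤ K (∫ ‖f‖² + Σᵢ ∫ ‖∂ᵢ f‖²)²` for every
smooth `f : 𝕋³ → F'` (from `Torus.lintegral_enorm_pow_four_le_sq_of_isSmooth`, `card (Fin 3) = 3`,
and `‖Df‖² ≤ 3 Σᵢ ‖∂ᵢ f‖²`). [folklore] -/
private theorem integral_norm_pow_four_le_aux :
    ∃ K : ℝ, 0 < K ∧ ∀ f : T3 → F', Torus.IsSmooth f →
      ∫ x, ‖f x‖ ^ 4 ≤ K * ((∫ x, ‖f x‖ ^ 2) + ∑ i, ∫ x, ‖Torus.partialDeriv i f x‖ ^ 2) ^ 2 := by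
  obtain ⟨K, hK⟩ := Torus.lintegral_enorm_pow_four_le_sq_of_isSmooth (d := Fin 3) (F' := F')
    (by rw [Fintype.card_fin]) (by rw [Fintype.card_fin]; norm_num)
  have hK0 : (0 : ℝ) ≤ K := NNReal.coe_nonneg K
  refine ⟨9 * K + 1, by positivity, fun f hf => ?_⟩
  have hf1 : Torus.IsContDiff 1 f := hf.isContDiff (by simp)
  set a : ℝ := ∫ x, ‖f x‖ ^ 2 with ha
  set b : Fin 3 → ℝ := fun i => ∫ x, ‖Torus.partialDeriv i f x‖ ^ 2 with hb
  have ha0 : 0 ≤ a := integral_nonneg fun _ => by positivity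
  have hb0 : ∀ i, 0 ≤ b i := fun i => integral_nonneg fun _ => by positivity
  have hsb0 : 0 ≤ ∑ i, b i := Finset.sum_nonneg fun i _ => hb0 i
  -- the densities as `ofReal` of real integrals
  have e4 : ∫⁻ x, ‖f x‖ₑ ^ 4 = ENNReal.ofReal (∫ x, ‖f x‖ ^ 4) :=
    lintegral_enorm_pow_eq_ofReal hf.continuous 4
  have e2 : ∫⁻ x, ‖f x‖ₑ ^ 2 = ENNReal.ofReal a := lintegral_enorm_pow_eq_ofReal hf.continuous 2
  have eB : ∀ i, ∫⁻ x, ‖Torus.partialDeriv i f x‖ₑ ^ 2 = ENNReal.ofReal (b i) := fun i =>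
    lintegral_enorm_pow_eq_ofReal (hf.partialDeriv i).continuous 2
  -- `‖Df‖ₑ² ≤ 3 Σᵢ ‖∂ᵢ f‖ₑ²` pointwise, hence `∫⁻ ‖Df‖ₑ² ≤ ofReal (3 Σᵢ bᵢ)`
  have hpt : ∀ y, ‖Torus.fderiv f y‖ₑ ^ 2 ≤ 3 * ∑ i, ‖Torus.partialDeriv i f y‖ₑ ^ 2 := by
    intro y
    have h := Torus.norm_fderiv_sq_le_card_mul_sum hf1 y
    rw [Fintype.card_fin] at h
    push_cast at h
    rw [← ofReal_norm, ← ENNReal.ofReal_pow (norm_nonneg _)]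
    refine (ENNReal.ofReal_le_ofReal h).trans (le_of_eq ?_)
    rw [ENNReal.ofReal_mul (by norm_num), ENNReal.ofReal_ofNat,
      ENNReal.ofReal_sum_of_nonneg (fun i _ => sq_nonneg _)]
    congr 1
    refine Finset.sum_congr rfl fun i _ => ?_
    rw [ENNReal.ofReal_pow (norm_nonneg _), ofReal_norm]
  have hmeas : ∀ i, Measurable fun y => ‖Torus.partialDeriv i f y‖ₑ ^ 2 := fun i =>
    (hf.partialDeriv i).continuous.enorm.measurable.pow_const 2
  have hD : ∫⁻ y, ‖Torus.fderiv f y‖ₑ ^ 2 ≤ ENNReal.ofReal (3 * ∑ i, b i) := by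
    calc ∫⁻ y, ‖Torus.fderiv f y‖ₑ ^ 2
        ≤ ∫⁻ y, 3 * ∑ i, ‖Torus.partialDeriv i f y‖ₑ ^ 2 := lintegral_mono hpt
      _ = 3 * ∑ i, ∫⁻ y, ‖Torus.partialDeriv i f y‖ₑ ^ 2 := by
          rw [lintegral_const_mul _ (Finset.measurable_sum _ fun i _ => hmeas i),
            lintegral_finsetSum _ fun i _ => hmeas i]
      _ = ENNReal.ofReal (3 * ∑ i, b i) := by
          rw [ENNReal.ofReal_mul (by norm_num), ENNReal.ofReal_ofNat,
            ENNReal.ofReal_sum_of_nonneg (fun i _ => hb0 i)]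
          congr 1
          exact Finset.sum_congr rfl fun i _ => eB i
  -- the `ℝ≥0∞` estimate, converted
  have h' : ENNReal.ofReal (∫ x, ‖f x‖ ^ 4) ≤ ENNReal.ofReal (K * (a + 3 * ∑ i, b i) ^ 2) := by
    calc ENNReal.ofReal (∫ x, ‖f x‖ ^ 4) = ∫⁻ x, ‖f x‖ₑ ^ 4 := e4.symm
      _ ≤ K * ((∫⁻ x, ‖f x‖ₑ ^ 2) + ∫⁻ x, ‖Torus.fderiv f x‖ₑ ^ 2) ^ 2 := hK f hf
      _ ≤ K * (ENNReal.ofReal a + ENNReal.ofReal (3 * ∑ i, b i)) ^ 2 := by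
          rw [e2]
          gcongr
      _ = ENNReal.ofReal (K * (a + 3 * ∑ i, b i) ^ 2) := by
          rw [← ENNReal.ofReal_add ha0 (by positivity), ← ENNReal.ofReal_pow (by positivity),
            ← ENNReal.ofReal_coe_nnreal, ← ENNReal.ofReal_mul hK0]
  rw [ENNReal.ofReal_le_ofReal_iff (by positivity)] at h'
  calc ∫ x, ‖f x‖ ^ 4 ≤ K * (a + 3 * ∑ i, b i) ^ 2 := h'
    _ ≤ K * (3 * (a + ∑ i, b i)) ^ 2 := by
        gcongr
        linarith
    _ = 9 * K * (a + ∑ i, b i) ^ 2 := by ring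
    _ ≤ (9 * K + 1) * (a + ∑ i, b i) ^ 2 := by
        gcongr
        linarith

end General

/-- **`H¹(𝕋³) ⊂ L⁴(𝕋³)`, real form** (Temam 1979, Ch. II §1.1, (1.13): the embedding behind the
continuity of the trilinear form for `n ≤ 4`; Evans 2010, §5.6.1): there is ONE constant `KS > 0`
such that every smooth real `f` on `𝕋³` satisfies `∫ f⁴ ≤ KS (∫ f² + Σᵢ ∫ (∂ᵢ f)²)²`
(the case `F' = ℝ` of the Bochner form of `Torus.lintegral_enorm_pow_four_le_sq_of_isSmooth`).
[folklore] -/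
theorem torus_integral_pow_four_le_sobolev_one :
    ∃ KS : ℝ, 0 < KS ∧ ∀ {f : T3 → ℝ}, Torus.IsSmooth f →
      ∫ x, f x ^ 4 ≤ KS * ((∫ x, f x ^ 2) + ∑ i, ∫ x, Torus.partialDeriv i f x ^ 2) ^ 2 := by
  obtain ⟨K, hK, h⟩ := integral_norm_pow_four_le_aux (F' := ℝ)
  refine ⟨K, hK, fun {f} hf => ?_⟩
  have h1 := h f hf
  have e4 : ∀ x, |f x| ^ 4 = f x ^ 4 := fun x => by
    rw [← abs_pow, abs_of_nonneg (by positivity)]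
  simp only [Real.norm_eq_abs, sq_abs, e4] at h1
  exact h1

/-- **`H¹(𝕋³) ⊂ L⁴(𝕋³)`, `V3`-valued form**: there is ONE constant `KS > 0` such that every smooth
`f : 𝕋³ → V3` satisfies `∫ ‖f‖⁴ ≤ KS (∫ ‖f‖² + Σᵢ ∫ ‖∂ᵢ f‖²)²`. [folklore] -/
theorem torus_integral_norm_pow_four_le_sobolev_one :
    ∃ KS : ℝ, 0 < KS ∧ ∀ {f : T3 → V3}, Torus.IsSmooth f →
      ∫ x, ‖f x‖ ^ 4 ≤ KS * ((∫ x, ‖f x‖ ^ 2) + ∑ i, ∫ x, ‖Torus.partialDeriv i f x‖ ^ 2) ^ 2 := by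
  obtain ⟨K, hK, h⟩ := integral_norm_pow_four_le_aux (F' := V3)
  exact ⟨K, hK, fun {f} hf => h f hf⟩

/-! ### Hölder `(4,4,2)` in real form -/

/-- **Hölder `L⁴ · L⁴ · L²` on `𝕋³`, real form**: for continuous real `f g h` on `𝕋³`,
`∫ |f| |g| |h| ≤ (∫ f⁴)^{1/4} (∫ g⁴)^{1/4} (∫ h²)^{1/2}` (Cauchy–Schwarz for `(|f||g|)·|h|` and
for `f²·g²`; `𝕋³` is compact, so all integrands are integrable). [folklore] -/
theorem torus_integral_abs_mul_mul_le_L4_L4_L2 :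
    ∀ {f g h : T3 → ℝ}, Continuous f → Continuous g → Continuous h →
      ∫ x, |f x| * |g x| * |h x| ≤
        (∫ x, f x ^ 4) ^ (1 / 4 : ℝ) * (∫ x, g x ^ 4) ^ (1 / 4 : ℝ) *
          (∫ x, h x ^ 2) ^ (1 / 2 : ℝ) := by
  intro f g h hf hg hh
  have hA0 : 0 ≤ ∫ x, f x ^ 4 := integral_nonneg fun x => by positivity
  have hB0 : 0 ≤ ∫ x, g x ^ 4 := integral_nonneg fun x => by positivity
  -- first Cauchy–Schwarz: `∫ (|f||g|)·|h| ≤ √(∫ f² g²) √(∫ h²)`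
  have h1 : ∫ x, |f x| * |g x| * |h x| ≤
      Real.sqrt (∫ x, (|f x| * |g x|) ^ 2) * Real.sqrt (∫ x, |h x| ^ 2) :=
    integral_mul_le_sqrt_mul_sqrt (hf.abs.mul hg.abs) hh.abs
      (fun x => mul_nonneg (abs_nonneg _) (abs_nonneg _)) fun x => abs_nonneg _
  have eP : ∀ x, (|f x| * |g x|) ^ 2 = f x ^ 2 * g x ^ 2 := fun x => by
    rw [mul_pow, sq_abs, sq_abs]
  have eh : ∀ x, |h x| ^ 2 = h x ^ 2 := fun x => sq_abs _
  simp only [eP, eh] at h1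
  -- second Cauchy–Schwarz: `∫ f² g² ≤ √(∫ f⁴) √(∫ g⁴)`
  have h2 : ∫ x, f x ^ 2 * g x ^ 2 ≤ Real.sqrt (∫ x, f x ^ 4) * Real.sqrt (∫ x, g x ^ 4) := by
    have h := integral_mul_le_sqrt_mul_sqrt (f := fun x => f x ^ 2) (g := fun x => g x ^ 2)
      (hf.pow 2) (hg.pow 2) (fun x => sq_nonneg _) fun x => sq_nonneg _
    have e4 : ∀ t : ℝ, (t ^ 2) ^ 2 = t ^ 4 := fun t => by ring
    simpa only [e4] using h
  calc ∫ x, |f x| * |g x| * |h x|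
      ≤ Real.sqrt (∫ x, f x ^ 2 * g x ^ 2) * Real.sqrt (∫ x, h x ^ 2) := h1
    _ ≤ Real.sqrt (Real.sqrt (∫ x, f x ^ 4) * Real.sqrt (∫ x, g x ^ 4)) *
          Real.sqrt (∫ x, h x ^ 2) := by gcongr
    _ = (∫ x, f x ^ 4) ^ (1 / 4 : ℝ) * (∫ x, g x ^ 4) ^ (1 / 4 : ℝ) *
          (∫ x, h x ^ 2) ^ (1 / 2 : ℝ) := by
        rw [Real.sqrt_mul (Real.sqrt_nonneg _), Real.sqrt_eq_rpow, Real.sqrt_eq_rpow,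
          Real.sqrt_eq_rpow, Real.sqrt_eq_rpow, Real.sqrt_eq_rpow, ← Real.rpow_mul hA0,
          ← Real.rpow_mul hB0]
        norm_num

/-! ### The packaged level-`3` tool -/

/-- **`(2,2)`-products via `L⁴` on `𝕋³`.** There is ONE constant `KS > 0` such that for all
smooth real `f g` and continuous real `h` on `𝕋³`,
`∫ |f| |g| |h| ≤ KS √(∫ f² + Σᵢ ∫ (∂ᵢ f)²) √(∫ g² + Σᵢ ∫ (∂ᵢ g)²) √(∫ h²)`
(Hölder `L⁴ · L⁴ · L²` and `H¹(𝕋³) ⊂ L⁴(𝕋³)`, `torus_integral_pow_four_le_sobolev_one`; `KS` is the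
square root of the constant there). [folklore] -/
theorem torus_l4_product_bound :
    ∃ KS : ℝ, 0 < KS ∧ ∀ {f g h : T3 → ℝ}, Torus.IsSmooth f → Torus.IsSmooth g → Continuous h →
      ∫ x, |f x| * |g x| * |h x| ≤
        KS * Real.sqrt ((∫ x, f x ^ 2) + ∑ i, ∫ x, Torus.partialDeriv i f x ^ 2) *
          Real.sqrt ((∫ x, g x ^ 2) + ∑ i, ∫ x, Torus.partialDeriv i g x ^ 2) *
            Real.sqrt (∫ x, h x ^ 2) := by
  obtain ⟨K, hK, hK4⟩ := torus_integral_pow_four_le_sobolev_one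
  refine ⟨Real.sqrt K, Real.sqrt_pos.2 hK, fun {f g h} hf hg hh => ?_⟩
  set Nf : ℝ := (∫ x, f x ^ 2) + ∑ i, ∫ x, Torus.partialDeriv i f x ^ 2 with hNf
  set Ng : ℝ := (∫ x, g x ^ 2) + ∑ i, ∫ x, Torus.partialDeriv i g x ^ 2 with hNg
  have hNf0 : 0 ≤ Nf := add_nonneg (integral_nonneg fun x => sq_nonneg _)
    (Finset.sum_nonneg fun i _ => integral_nonneg fun x => sq_nonneg _)
  have hNg0 : 0 ≤ Ng := add_nonneg (integral_nonneg fun x => sq_nonneg _)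
    (Finset.sum_nonneg fun i _ => integral_nonneg fun x => sq_nonneg _)
  have hfc : Continuous f := hf.continuous
  have hgc : Continuous g := hg.continuous
  -- first Cauchy–Schwarz
  have h1 : ∫ x, |f x| * |g x| * |h x| ≤
      Real.sqrt (∫ x, (|f x| * |g x|) ^ 2) * Real.sqrt (∫ x, |h x| ^ 2) :=
    integral_mul_le_sqrt_mul_sqrt (hfc.abs.mul hgc.abs) hh.abs
      (fun x => mul_nonneg (abs_nonneg _) (abs_nonneg _)) fun x => abs_nonneg _
  have eP : ∀ x, (|f x| * |g x|) ^ 2 = f x ^ 2 * g x ^ 2 := fun x => by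
    rw [mul_pow, sq_abs, sq_abs]
  have eh : ∀ x, |h x| ^ 2 = h x ^ 2 := fun x => sq_abs _
  simp only [eP, eh] at h1
  -- second Cauchy–Schwarz and `H¹ ⊂ L⁴`: `∫ f² g² ≤ √(∫ f⁴) √(∫ g⁴) ≤ K · Nf · Ng`
  have h2 : ∫ x, f x ^ 2 * g x ^ 2 ≤ K * Nf * Ng := by
    have h := integral_mul_le_sqrt_mul_sqrt (f := fun x => f x ^ 2) (g := fun x => g x ^ 2)
      (hfc.pow 2) (hgc.pow 2) (fun x => sq_nonneg _) fun x => sq_nonneg _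
    have e4 : ∀ t : ℝ, (t ^ 2) ^ 2 = t ^ 4 := fun t => by ring
    simp only [e4] at h
    have h4f : Real.sqrt (∫ x, f x ^ 4) ≤ Real.sqrt K * Nf :=
      calc Real.sqrt (∫ x, f x ^ 4) ≤ Real.sqrt (K * Nf ^ 2) := Real.sqrt_le_sqrt (hK4 hf)
        _ = Real.sqrt K * Nf := by rw [Real.sqrt_mul hK.le, Real.sqrt_sq hNf0]
    have h4g : Real.sqrt (∫ x, g x ^ 4) ≤ Real.sqrt K * Ng :=
      calc Real.sqrt (∫ x, g x ^ 4) ≤ Real.sqrt (K * Ng ^ 2) := Real.sqrt_le_sqrt (hK4 hg)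
        _ = Real.sqrt K * Ng := by rw [Real.sqrt_mul hK.le, Real.sqrt_sq hNg0]
    calc ∫ x, f x ^ 2 * g x ^ 2 ≤ Real.sqrt (∫ x, f x ^ 4) * Real.sqrt (∫ x, g x ^ 4) := h
      _ ≤ (Real.sqrt K * Nf) * (Real.sqrt K * Ng) :=
          mul_le_mul h4f h4g (Real.sqrt_nonneg _) (by positivity)
      _ = K * Nf * Ng := by
          have : Real.sqrt K * Real.sqrt K = K := Real.mul_self_sqrt hK.le
          linear_combination Nf * Ng * this
  calc ∫ x, |f x| * |g x| * |h x|
      ≤ Real.sqrt (∫ x, f x ^ 2 * g x ^ 2) * Real.sqrt (∫ x, h x ^ 2) := h1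
    _ ≤ Real.sqrt (K * Nf * Ng) * Real.sqrt (∫ x, h x ^ 2) := by gcongr
    _ = Real.sqrt K * Real.sqrt Nf * Real.sqrt Ng * Real.sqrt (∫ x, h x ^ 2) := by
        rw [Real.sqrt_mul (by positivity) Ng, Real.sqrt_mul hK.le Nf]

/-- **`(2,2)`-products via `L⁴` on `𝕋³`, weighted form.** There is ONE constant `KS > 0` such that
for every continuous multiplier `w` with `|w| ≤ M`, all continuous weights `ω₁ ω₂ ω₃` on `𝕋³` with
`0 < mₖ ≤ ωₖ`, all smooth real `f g` and every continuous real `h`,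
`∫ |w| |f| |g| |h| ≤ KS M √(m₁⁻¹ (∫ ω₁ f² + Σᵢ ∫ ω₁ (∂ᵢ f)²)) √(m₂⁻¹ (∫ ω₂ g² + Σᵢ ∫ ω₂ (∂ᵢ g)²))
  √(m₃⁻¹ ∫ ω₃ h²)`
(`torus_l4_product_bound` and the weighted-to-plain comparison `∫ q² ≤ m⁻¹ ∫ ω q²`,
`torus_integral_sq_le_of_le_weight`, on each of the `1 + 3`, `1 + 3`, `1` plain integrals).
[folklore] -/
theorem torus_l4_product_bound_weighted :
    ∃ KS : ℝ, 0 < KS ∧ ∀ {w ω₁ ω₂ ω₃ : T3 → ℝ} {M m₁ m₂ m₃ : ℝ},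
      Continuous w → Continuous ω₁ → Continuous ω₂ → Continuous ω₃ → (∀ x, |w x| ≤ M) →
      0 < m₁ → 0 < m₂ → 0 < m₃ → (∀ x, m₁ ≤ ω₁ x) → (∀ x, m₂ ≤ ω₂ x) → (∀ x, m₃ ≤ ω₃ x) →
      ∀ {f g h : T3 → ℝ}, Torus.IsSmooth f → Torus.IsSmooth g → Continuous h →
        ∫ x, |w x| * |f x| * |g x| * |h x| ≤
          KS * M *
            Real.sqrt (m₁⁻¹ * ((∫ x, ω₁ x * f x ^ 2) +
              ∑ i, ∫ x, ω₁ x * Torus.partialDeriv i f x ^ 2)) *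
            Real.sqrt (m₂⁻¹ * ((∫ x, ω₂ x * g x ^ 2) +
              ∑ i, ∫ x, ω₂ x * Torus.partialDeriv i g x ^ 2)) *
            Real.sqrt (m₃⁻¹ * ∫ x, ω₃ x * h x ^ 2) := by
  obtain ⟨K, hK, hP⟩ := torus_l4_product_bound
  refine ⟨K, hK, ?_⟩
  intro w ω₁ ω₂ ω₃ M m₁ m₂ m₃ hw hω₁ hω₂ hω₃ hwM hm₁ hm₂ hm₃ hle₁ hle₂ hle₃ f g h hf hg hh
  have hM0 : 0 ≤ M := (abs_nonneg _).trans (hwM 0)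
  have hfc : Continuous f := hf.continuous
  have hgc : Continuous g := hg.continuous
  set Nf : ℝ := (∫ x, f x ^ 2) + ∑ i, ∫ x, Torus.partialDeriv i f x ^ 2 with hNf
  set Ng : ℝ := (∫ x, g x ^ 2) + ∑ i, ∫ x, Torus.partialDeriv i g x ^ 2 with hNg
  set H : ℝ := ∫ x, h x ^ 2 with hH
  -- plain quantities are bounded by `m⁻¹ ×` weighted ones
  have hNf : Nf ≤ m₁⁻¹ * ((∫ x, ω₁ x * f x ^ 2) + ∑ i, ∫ x, ω₁ x * Torus.partialDeriv i f x ^ 2) := by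
    rw [mul_add, Finset.mul_sum]
    exact add_le_add (torus_integral_sq_le_of_le_weight hfc hω₁ hm₁ hle₁)
      (Finset.sum_le_sum fun i _ =>
        torus_integral_sq_le_of_le_weight (hf.partialDeriv i).continuous hω₁ hm₁ hle₁)
  have hNg : Ng ≤ m₂⁻¹ * ((∫ x, ω₂ x * g x ^ 2) + ∑ i, ∫ x, ω₂ x * Torus.partialDeriv i g x ^ 2) := by
    rw [mul_add, Finset.mul_sum]
    exact add_le_add (torus_integral_sq_le_of_le_weight hgc hω₂ hm₂ hle₂)
      (Finset.sum_le_sum fun i _ =>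
        torus_integral_sq_le_of_le_weight (hg.partialDeriv i).continuous hω₂ hm₂ hle₂)
  have hHle : H ≤ m₃⁻¹ * ∫ x, ω₃ x * h x ^ 2 := torus_integral_sq_le_of_le_weight hh hω₃ hm₃ hle₃
  -- `∫ |w||f||g||h| ≤ M ∫ |f||g||h|`
  have hi1 : Integrable (fun x => |w x| * |f x| * |g x| * |h x|) volume :=
    (((hw.abs.mul hfc.abs).mul hgc.abs).mul hh.abs).integrable_unitAddTorus
  have hi2 : Integrable (fun x => |f x| * |g x| * |h x|) volume :=
    ((hfc.abs.mul hgc.abs).mul hh.abs).integrable_unitAddTorus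
  have hwle : ∫ x, |w x| * |f x| * |g x| * |h x| ≤ M * ∫ x, |f x| * |g x| * |h x| := by
    rw [← integral_const_mul]
    refine integral_mono hi1 (hi2.const_mul M) fun x => ?_
    have h0 : 0 ≤ |f x| * |g x| * |h x| := by positivity
    calc |w x| * |f x| * |g x| * |h x| = |w x| * (|f x| * |g x| * |h x|) := by ring
      _ ≤ M * (|f x| * |g x| * |h x|) := mul_le_mul_of_nonneg_right (hwM x) h0
  calc ∫ x, |w x| * |f x| * |g x| * |h x| ≤ M * ∫ x, |f x| * |g x| * |h x| := hwle
    _ ≤ M * (K * Real.sqrt Nf * Real.sqrt Ng * Real.sqrt H) :=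
        mul_le_mul_of_nonneg_left (hP hf hg hh) hM0
    _ ≤ M * (K * Real.sqrt (m₁⁻¹ * ((∫ x, ω₁ x * f x ^ 2) +
              ∑ i, ∫ x, ω₁ x * Torus.partialDeriv i f x ^ 2)) *
            Real.sqrt (m₂⁻¹ * ((∫ x, ω₂ x * g x ^ 2) +
              ∑ i, ∫ x, ω₂ x * Torus.partialDeriv i g x ^ 2)) *
            Real.sqrt (m₃⁻¹ * ∫ x, ω₃ x * h x ^ 2)) := by
        gcongr
    _ = _ := by ring

end HsEulerCalc

end Literature.MathematicalPhysics.KineticTheory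

end
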